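import Literature.AlgebraicGeometry.Motives.CechComplexFieldPointBaseChange
import Literature.AlgebraicGeometry.Motives.CartierDivisorFibreSections
import HarnessLib

/-!
# Compatible families of local sections are `Γ(Z, 𝒪_Z(D_g))` (the sheaf axiom for `g^*𝒪_Y(D)`)

Let `Y`, `Z` be integral schemes, `pr : Y → B`, `D = (U_i, f_i)` a Cartier divisor on `Y`,
`V ⊆ B` open, `𝔚 = (W_0, …, W_r)` a Čech cover of `pr⁻¹V` (`Motives/CartierDivisorCech`) and
`g : Z → Y` a morphism with `g(Z) ⊆ pr⁻¹V`, so that the `g⁻¹W_a` cover `Z`; let `Z` be a scheme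
over a field `L`. `Motives/CechComplexFieldPointBaseChange` defines the module
`FieldPointBaseChange.compatible` of compatible families `(h_a ∈ Γ(g⁻¹W_a, 𝒪_Z))_a`,
`h_a| = h_b| · g^♯(f_{c(a)}/f_{c(b)})` on `g⁻¹W_{ab}` for `a < b`, i.e. the Čech `Ȟ⁰` of the line
bundle `g^*𝒪_Y(D)` on the cover `(g⁻¹W_a)_a` in the trivialisations `g^*(f_{c(a)}⁻¹)`, and
identifies it with `Ker(d⁰_Č ⊗_A L)`. This file PROVES that it is the space of global sections of
`𝒪_Z(D_g)`, `D_g` the class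
pullback of `D` along `g` (`Motives/CartierDivisorClassPullback`: `D_g = g^*(D - div f_{i₀})`,
`i₀` the chart of `D` at `g(η_Z)`, with charts `g⁻¹U_j` and equations `g^♯(f_j/f_{i₀})`,
`Motives/CartierDivisorFibreSections`), in the function-field model of `Motives/CartierDivisor`
(`CartierDivisor.sections L ⊆ L(Z)`):

* `FieldPointBaseChange.compatibleEquivSections` — **compatible families `≅ Γ(Z, 𝒪_Z(D_g))`**
  `L`-linearly. The map sends a compatible family `(h_a)` to the rational function
  `h_a · g^♯(f_{c(a)}/f_{i₀})⁻¹ ∈ L(Z)` for any `a` with `g⁻¹W_a ≠ ∅` (independent of `a` by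
  compatibility: on `g⁻¹W_{ab} ∋ η_Z`, `h_b g^♯(f_{c(a)}/f_{c(b)}) = h_a`), which is a section of
  `𝒪_Z(D_g)` since on `g⁻¹(W_a ∩ U_j)`
  its product with the equation `g^♯(f_j/f_{i₀})` is `g^♯(f_j/f_{c(a)}) · h_a`, regular; it is
  injective (`Γ(W, 𝒪_Z) → L(Z)` is injective for `W ≠ ∅`, and `Γ(∅, 𝒪_Z) = 0`) and surjective (a
  section `s` comes from `h_a =` the section of `𝒪_Z` over `g⁻¹W_a` with rational function
  `g^♯(f_{c(a)}/f_{i₀}) · s`; Görtz–Wedhorn I, Prop. 3.29 (3)). This is the sheaf axiom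
  `Ȟ⁰((g⁻¹W_a)_a, 𝒪_Z(D_g)) = Γ(Z, 𝒪_Z(D_g))` (Görtz–Wedhorn II, Lemma 21.65) for the line bundle
  `𝒪_Z(D_g) ≅ g^*𝒪_Y(D)` (Görtz–Wedhorn I, (11.16): "`f^*𝒪(D) ≅ 𝒪(f^*D)`").

Everything is proved; the inputs from this tree are `CartierDivisor.classPullback_f`,
`classPullbackChart`, `isUnitAt_f_div_f_chartAt` (`Motives/CartierDivisorFibreSections`, whose
`Motives/CechComplexH0Fibre` sequel does the residue-field case `Spec κ(t) → T` of this file by a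
parallel argument), `RatFn.ofSection_appLE`, `RatFn.section_ext`
(`Motives/CartierDivisorCocycleIntegral`, `Motives/CartierDivisorCocycle`), `RatFn.sectionOf`
(`Motives/CartierDivisorExtension`), the pullback calculus `RatFn.pullbackFn_mul/_div/_inv`
(`Motives/CartierDivisorClassPullback`) and `OrderedCech.src/tgt/src_edge/tgt_edge`
(`Literature/Algebra/Homology/OrderedCechBaseChange`). Mathlib searched (pin): `TopCat.Sheaf.isTerminalOfEqEmpty`,
`CommRingCat.subsingleton_of_isTerminal`, `LinearEquiv.ofBijective` (used); Mathlib has no Cartier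
divisors or line bundles on schemes.

## References

* U. Görtz, T. Wedhorn, *Algebraic Geometry II: Cohomology of Schemes*, Springer Spektrum (2023),
  doi:10.1007/978-3-658-43031-3: Lemma 21.65, p. 259; proof of Prop. 22.90, p. 388 (read via the
  held copy). [GortzWedhorn2023]
* U. Görtz, T. Wedhorn, *Algebraic Geometry I: Schemes*, 2nd ed. (2020): Prop. 3.29 (2), (3),
  p. 102; (11.9), p. 374; (11.16), Def. 11.49, p. 392. [GortzWedhorn2020]
-/

universe u

open CategoryTheory CategoryTheory.Limits AlgebraicGeometry TopologicalSpace Opposite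
open Literature.Algebra.Homology

noncomputable section

namespace Literature.AlgebraicGeometry.Motives

open RatFn

namespace FieldPointBaseChange

/-! ### The local equations of `D_g` on the opens `g⁻¹W_σ`, and the cover `(g⁻¹W_a)` of `Z` -/

section Equations

variable {B Y Z : Scheme.{u}} [IsIntegral Y] [IsIntegral Z] {pr : Y ⟶ B} (g : Z ⟶ Y)
  {V : B.Opens} {D : CartierDivisor Y} (𝔚 : CartierDivisor.CechCover pr V D)

omit [IsIntegral Y] in
/-- Over an open missing the generic point (i.e. `∅`) the sections of `𝒪_Z` are `0`. [folklore] -/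
theorem subsingleton_sections_of_notMem {W' : Z.Opens} (hξ : genericPoint Z ∉ W') :
    Subsingleton Γ(Z, W') := by
  have hbot : W' = ⊥ := le_bot_iff.1 fun x hx => hξ (genericPoint_mem_of_mem hx)
  exact CommRingCat.subsingleton_of_isTerminal (Z.sheaf.isTerminalOfEqEmpty (by rw [hbot]))

/-- **The equation of `D_g` attached to a simplex**: `e_s = g^♯(f_{c(s)} / f_{i₀}) ∈ L(Z)`, the
local equation of `D_g = classPullback D g` on the chart `g⁻¹U_{c(s)} ⊇ g⁻¹W_s`
(`CartierDivisor.classPullback_f`; meaningful when `g(η_Z) ∈ U_{c(s)}`, e.g. `g⁻¹W_s ≠ ∅`).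
[folklore] -/
def eqn (s : Finset (Fin (𝔚.r + 1))) (hs : s.Nonempty) : Z.functionField :=
  pullbackFn g (D.f (𝔚.chartOf s hs) * (D.f (D.chartAt (g (genericPoint Z))))⁻¹)

variable {g 𝔚}

/-- If `η_Z ∈ g⁻¹W_s` then `g(η_Z) ∈ U_{c(s)}`. [folklore] -/
theorem apply_genericPoint_mem_U_chartOf {s : Finset (Fin (𝔚.r + 1))} (hs : s.Nonempty)
    (hξ : genericPoint Z ∈ g ⁻¹ᵁ 𝔚.opens s) : g (genericPoint Z) ∈ D.U (𝔚.chartOf s hs) :=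
  𝔚.opens_le_U_chartOf s hs hξ

/-- `f_{c(s)} / f_{i₀}` is a unit at `g(η_Z)` when `η_Z ∈ g⁻¹W_s`. [folklore] -/
theorem isUnitAt_f_chartOf {s : Finset (Fin (𝔚.r + 1))} (hs : s.Nonempty)
    (hξ : genericPoint Z ∈ g ⁻¹ᵁ 𝔚.opens s) :
    IsUnitAt (g (genericPoint Z))
      (D.f (𝔚.chartOf s hs) * (D.f (D.chartAt (g (genericPoint Z))))⁻¹) :=
  D.isUnitAt_f_div_f_chartAt g (apply_genericPoint_mem_U_chartOf hs hξ)

/-- `e_s ≠ 0` when `η_Z ∈ g⁻¹W_s`. [folklore] -/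
theorem eqn_ne_zero {s : Finset (Fin (𝔚.r + 1))} (hs : s.Nonempty)
    (hξ : genericPoint Z ∈ g ⁻¹ᵁ 𝔚.opens s) : eqn g 𝔚 s hs ≠ 0 :=
  pullbackFn_ne_zero g (isUnitAt_f_chartOf hs hξ)

/-- `e_s` is the local equation of `D_g` on the chart `g⁻¹U_{c(s)}`. [folklore] -/
theorem classPullback_f_chart {s : Finset (Fin (𝔚.r + 1))} (hs : s.Nonempty)
    (hξ : genericPoint Z ∈ g ⁻¹ᵁ 𝔚.opens s) :
    (D.classPullback g).f (D.classPullbackChart g (apply_genericPoint_mem_U_chartOf hs hξ)) =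
      eqn g 𝔚 s hs :=
  rfl

/-- **The cocycle relation between the equations**: for an edge `τ = {a < b}` with `η_Z ∈ g⁻¹W_τ`,
`e_b · g^♯(u_τ) = e_a` where `u_τ = f_{c(a)}/f_{c(b)}` (`CechCover.unitSection`; `a = min τ` with
`c(a) = c(τ)`, `b = max τ`). [folklore] -/
theorem eqn_tgt_mul_ofSection_unitSection (τ : OrderedCech.Simplex (Fin (𝔚.r + 1)) 1)
    (hξ : genericPoint Z ∈ g ⁻¹ᵁ 𝔚.opens τ.1) :
    eqn g 𝔚 (OrderedCech.tgt τ).1 (OrderedCech.tgt τ).2.1 *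
        ofSection hξ (g.appLE (𝔚.opens τ.1) (g ⁻¹ᵁ 𝔚.opens τ.1) le_rfl (𝔚.unitSection τ)) =
      eqn g 𝔚 (OrderedCech.src τ).1 (OrderedCech.src τ).2.1 := by
  have htgt : genericPoint Z ∈ g ⁻¹ᵁ 𝔚.opens (OrderedCech.tgt τ).1 :=
    g.preimage_mono (𝔚.opens_le_opens_tgt τ) hξ
  rw [ofSection_appLE g (le_refl _) hξ, CartierDivisor.CechCover.ofSection_unitSection]
  unfold eqn
  rw [CartierDivisor.CechCover.chartOf_src]
  have hu := isUnitAt_f_chartOf (OrderedCech.tgt τ).2.1 htgt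
  have hreg : IsRegularAt (g (genericPoint Z)) (D.f (𝔚.chartOf τ.1 τ.2.1) /
      D.f (𝔚.chartOf (OrderedCech.tgt τ).1 (OrderedCech.tgt τ).2.1)) :=
    (D.isUnitAt_div _ _ _ (𝔚.opens_le_U_chartOf _ _ hξ)
      ((𝔚.opens_le_U_inf_U τ) hξ).2).isRegularAt
  rw [← pullbackFn_mul g hu.isRegularAt hreg]
  congr 1
  field_simp [D.f_ne_zero (𝔚.chartOf (OrderedCech.tgt τ).1 (OrderedCech.tgt τ).2.1)]

variable (g 𝔚)

/-- The rational function attached to a section `x ∈ Γ(g⁻¹W_s, 𝒪_Z)` in the trivialisation of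
`𝒪_Z(D_g)` on `g⁻¹W_s`: `x · e_s⁻¹` (for `g⁻¹W_s ∋ η_Z`). [folklore] -/
def ratFn {s : Finset (Fin (𝔚.r + 1))} (hs : s.Nonempty) (hξ : genericPoint Z ∈ g ⁻¹ᵁ 𝔚.opens s)
    (x : Γ(Z, g ⁻¹ᵁ 𝔚.opens s)) : Z.functionField :=
  ofSection hξ x * (eqn g 𝔚 s hs)⁻¹

variable {g} (hcov : ∀ z : Z, g z ∈ pr ⁻¹ᵁ V)

omit [IsIntegral Z] in
include hcov in
/-- Every point of `Z` lies in some `g⁻¹W_a` (the `W_a` cover `pr⁻¹V ⊇ g(Z)`). [folklore] -/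
theorem exists_mem_preimage_opens_vertex (z : Z) :
    ∃ a, z ∈ g ⁻¹ᵁ 𝔚.opens (OrderedCech.vertex a).1 := by
  have hz : g z ∈ ⨆ a, 𝔚.W a := by rw [𝔚.iSup_W]; exact hcov z
  obtain ⟨a, ha⟩ := Opens.mem_iSup.1 hz
  exact ⟨a, 𝔚.mem_opens_iff.2 ⟨hcov z, fun c hc => by
    rw [OrderedCech.vertex_val, Finset.mem_singleton] at hc; subst hc; exact ha⟩⟩

/-- A vertex `a₀` with `η_Z ∈ g⁻¹W_{a₀}` (chosen once and for all). [folklore] -/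
def vertex₀ : Fin (𝔚.r + 1) := (exists_mem_preimage_opens_vertex 𝔚 hcov (genericPoint Z)).choose

/-- `η_Z ∈ g⁻¹W_{a₀}`. [folklore] -/
theorem genericPoint_mem_vertex₀ :
    genericPoint Z ∈ g ⁻¹ᵁ 𝔚.opens (OrderedCech.vertex (vertex₀ 𝔚 hcov)).1 :=
  (exists_mem_preimage_opens_vertex 𝔚 hcov (genericPoint Z)).choose_spec

end Equations

/-! ### Compatible families `≅ Γ(Z, 𝒪_Z(D_g))` -/

section OverField

attribute [local instance] overSecAlgebra

variable {L : Type u} [Field L] {B Y Z : Scheme.{u}} [IsIntegral Y] [IsIntegral Z] {pr : Y ⟶ B}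
  {g : Z ⟶ Y} [Z.Over (Spec (.of L))] {V : B.Opens} {D : CartierDivisor Y}
  (𝔚 : CartierDivisor.CechCover pr V D)

omit [IsIntegral Y] in
/-- "Rational function of a section" is compatible with the `L`-structures:
`L → Γ(W', 𝒪_Z) → L(Z)` is the structure map `L → L(Z)` of the `L`-scheme `Z`
(`RatFn.algebraStalk`). [folklore] -/
theorem ofSection_algebraMap_over {W' : Z.Opens} (hξ : genericPoint Z ∈ W') (l : L) :
    ofSection hξ (algebraMap L Γ(Z, W') l) = algebraMap L Z.functionField l := by
  change ofSection hξ (((Scheme.ΓSpecIso (.of L)).inv ≫ (Z ↘ Spec (.of L)).appLE ⊤ W' le_top) l) =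
    Z.presheaf.germ ⊤ (genericPoint Z) trivial
      ((Z ↘ Spec (.of L)).appTop ((Scheme.ΓSpecIso (.of L)).inv l))
  simp only [Scheme.Hom.appLE]
  exact ofSection_map (homOfLE le_top) hξ _

omit [IsIntegral Y] in
/-- `ofSection (l • x) = l • ofSection x`. [folklore] -/
theorem ofSection_smul {W' : Z.Opens} (hξ : genericPoint Z ∈ W') (l : L) (x : Γ(Z, W')) :
    ofSection hξ (l • x) = l • ofSection hξ x := by
  rw [Algebra.smul_def, Algebra.smul_def, ← ofSection_algebraMap_over hξ l]
  exact map_mul _ _ _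

variable {𝔚} in
/-- **Independence of the vertex**: for a compatible family `h` the rational functions
`h_a · e_a⁻¹` agree for all vertices `a` with `g⁻¹W_a ∋ η_Z` (compare on `g⁻¹W_{ab} ∋ η_Z`:
`h_a = h_b · g^♯(u_{ab})` and `e_a = e_b · g^♯(u_{ab})`). [folklore] -/
theorem ratFn_eq_of_mem_compatible
    {h : ∀ σ : OrderedCech.Simplex (Fin (𝔚.r + 1)) 0, Γ(Z, g ⁻¹ᵁ 𝔚.opens σ.1)}
    (hh : h ∈ compatible L g 𝔚) {a b : Fin (𝔚.r + 1)}
    (ha : genericPoint Z ∈ g ⁻¹ᵁ 𝔚.opens (OrderedCech.vertex a).1)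
    (hb : genericPoint Z ∈ g ⁻¹ᵁ 𝔚.opens (OrderedCech.vertex b).1) :
    ratFn g 𝔚 (OrderedCech.vertex a).2.1 ha (h (OrderedCech.vertex a)) =
      ratFn g 𝔚 (OrderedCech.vertex b).2.1 hb (h (OrderedCech.vertex b)) := by
  -- reduce to `a < b`
  wlog hab : a < b generalizing a b
  · rcases eq_or_lt_of_le (not_lt.1 hab) with e | hlt
    · subst e; rfl
    · exact (this hb ha hlt).symm
  -- the edge `σ = {a < b}`: `src σ = {a}`, `tgt σ = {b}`, `η_Z ∈ g⁻¹W_σ`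
  let σ : OrderedCech.Simplex (Fin (𝔚.r + 1)) 1 := OrderedCech.edge a b hab
  have hsrc : OrderedCech.src σ = OrderedCech.vertex a := OrderedCech.src_edge a b hab
  have htgt : OrderedCech.tgt σ = OrderedCech.vertex b := OrderedCech.tgt_edge a b hab
  have hξ : genericPoint Z ∈ g ⁻¹ᵁ 𝔚.opens σ.1 := by
    change g (genericPoint Z) ∈ 𝔚.opens {a, b}
    rw [𝔚.mem_opens_iff]
    have ha' := 𝔚.mem_opens_iff.1 ha
    have hb' := 𝔚.mem_opens_iff.1 hb
    refine ⟨ha'.1, fun c hc => ?_⟩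
    rcases Finset.mem_insert.1 hc with rfl | hc
    · exact ha'.2 c (Finset.mem_singleton_self c)
    · rw [Finset.mem_singleton] at hc
      subst hc
      exact hb'.2 c (Finset.mem_singleton_self c)
  -- the compatibility on `σ`, in `L(Z)`, and the cocycle relation of the equations
  have hδ := (mem_compatible_iff.1 hh) σ
  have hδ' := congr_arg (ofSection hξ) hδ
  simp only [map_mul, ofSection_map] at hδ'
  have key := eqn_tgt_mul_ofSection_unitSection σ hξ
  have hu : ofSection hξ (g.appLE (𝔚.opens σ.1) (g ⁻¹ᵁ 𝔚.opens σ.1) le_rfl (𝔚.unitSection σ))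
      ≠ 0 := by
    intro h0
    rw [h0, mul_zero] at key
    exact eqn_ne_zero _ (g.preimage_mono (𝔚.opens_le_opens_src σ) hξ) key.symm
  -- transport along `src σ = {a}`, `tgt σ = {b}`
  revert hδ' key hu
  generalize 𝔚.opens_le_opens_src σ = h₁
  generalize 𝔚.opens_le_opens_tgt σ = h₂
  revert h₁ h₂
  rw [hsrc, htgt]
  intro h₁ h₂ hδ' key hu
  -- conclude: `h_a e_a⁻¹ = (h_b u)(e_b u)⁻¹ = h_b e_b⁻¹`
  unfold ratFn
  rw [← key, hδ', mul_inv, mul_assoc]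
  congr 1
  rw [mul_left_comm, mul_inv_cancel₀ hu, mul_one]

variable (L) (hcov : ∀ z : Z, g z ∈ pr ⁻¹ᵁ V)

/-- **The rational function of a family** `h ∈ Π_a Γ(g⁻¹W_a, 𝒪_Z)`: `h_{a₀} · e_{a₀}⁻¹`, an
`L`-linear map to `L(Z)`. [folklore] -/
def toRatFn : (∀ σ : OrderedCech.Simplex (Fin (𝔚.r + 1)) 0, Γ(Z, g ⁻¹ᵁ 𝔚.opens σ.1)) →ₗ[L]
    Z.functionField where
  toFun h := ratFn g 𝔚 (OrderedCech.vertex (vertex₀ 𝔚 hcov)).2.1 (genericPoint_mem_vertex₀ 𝔚 hcov)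
    (h (OrderedCech.vertex (vertex₀ 𝔚 hcov)))
  map_add' h h' := by
    simp only [ratFn, Pi.add_apply, map_add, add_mul]
  map_smul' l h := by
    simp only [ratFn, Pi.smul_apply, RingHom.id_apply, ofSection_smul, smul_mul_assoc]

variable {L}

/-- `toRatFn`, unfolded. [folklore] -/
theorem toRatFn_apply (h : ∀ σ : OrderedCech.Simplex (Fin (𝔚.r + 1)) 0, Γ(Z, g ⁻¹ᵁ 𝔚.opens σ.1)) :
    toRatFn L 𝔚 hcov h = ratFn g 𝔚 (OrderedCech.vertex (vertex₀ 𝔚 hcov)).2.1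
      (genericPoint_mem_vertex₀ 𝔚 hcov) (h (OrderedCech.vertex (vertex₀ 𝔚 hcov))) :=
  rfl

/-- For a compatible family `h`, `toRatFn h = h_a · e_a⁻¹` for every vertex `a` with `η_Z ∈ g⁻¹W_a`.
[folklore] -/
theorem toRatFn_eq_ratFn
    {h : ∀ σ : OrderedCech.Simplex (Fin (𝔚.r + 1)) 0, Γ(Z, g ⁻¹ᵁ 𝔚.opens σ.1)}
    (hh : h ∈ compatible L g 𝔚) {a : Fin (𝔚.r + 1)}
    (ha : genericPoint Z ∈ g ⁻¹ᵁ 𝔚.opens (OrderedCech.vertex a).1) :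
    toRatFn L 𝔚 hcov h = ratFn g 𝔚 (OrderedCech.vertex a).2.1 ha (h (OrderedCech.vertex a)) :=
  ratFn_eq_of_mem_compatible hh _ _

/-! ### Compatible families `→ Γ(Z, 𝒪_Z(D_g))` -/

/-- **The rational function of a compatible family is a global section of `𝒪_Z(D_g)`**: near a point
`z ∈ g⁻¹(W_a ∩ U_j)` it is `h_a e_a⁻¹`, and `g^♯(f_j/f_{i₀}) · h_a e_a⁻¹ = g^♯(f_j/f_{c(a)}) · h_a`
with `g^♯(f_j/f_{c(a)})` a unit at `z`. [folklore] -/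
theorem isSection_toRatFn
    {h : ∀ σ : OrderedCech.Simplex (Fin (𝔚.r + 1)) 0, Γ(Z, g ⁻¹ᵁ 𝔚.opens σ.1)}
    (hh : h ∈ compatible L g 𝔚) : (D.classPullback g).IsSection (toRatFn L 𝔚 hcov h) := by
  intro j z hjz
  obtain ⟨a, hza⟩ := exists_mem_preimage_opens_vertex 𝔚 hcov z
  have ha : genericPoint Z ∈ g ⁻¹ᵁ 𝔚.opens (OrderedCech.vertex a).1 := genericPoint_mem_of_mem hza
  have hu := isUnitAt_f_chartOf (OrderedCech.vertex a).2.1 ha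
  rw [toRatFn_eq_ratFn 𝔚 hcov hh ha, ratFn, CartierDivisor.classPullback_f, mul_left_comm, eqn,
    ← pullbackFn_inv g hu,
    ← pullbackFn_mul g (D.isUnitAt_f_div_f_chartAt g (D.apply_genericPoint_mem_U g j)).isRegularAt
      hu.inv.isRegularAt]
  refine IsRegularAt.mul (isRegularAt_ofSection hza _) (IsUnitAt.pullbackFn ?_).isRegularAt
  have hz₁ : g z ∈ D.U j.1.1 := by
    rw [CartierDivisor.classPullback_U] at hjz
    exact hjz.1
  have hz₂ : g z ∈ D.U (𝔚.chartOf (OrderedCech.vertex a).1 (OrderedCech.vertex a).2.1) :=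
    𝔚.opens_le_U_chartOf _ _ hza
  convert D.isUnitAt_div _ _ (g z) hz₁ hz₂ using 1
  field_simp [D.f_ne_zero (D.chartAt (g (genericPoint Z))), D.f_ne_zero j.1.1,
    D.f_ne_zero (𝔚.chartOf (OrderedCech.vertex a).1 (OrderedCech.vertex a).2.1)]

variable (L)

/-- The rational function of a family, restricted to the compatible families (an auxiliary
`L`-linear map `compatible → L(Z)`). [folklore] -/
def compatibleToRatFn : compatible L g 𝔚 →ₗ[L] Z.functionField :=
  (toRatFn L 𝔚 hcov).comp (compatible L g 𝔚).subtype

variable {L}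

/-- `compatibleToRatFn h = toRatFn h`. [folklore] -/
theorem compatibleToRatFn_apply (h : compatible L g 𝔚) :
    compatibleToRatFn L 𝔚 hcov h = toRatFn L 𝔚 hcov h.1 :=
  rfl

/-- `compatibleToRatFn` takes values in `Γ(Z, 𝒪_Z(D_g))`. [folklore] -/
theorem compatibleToRatFn_mem (h : compatible L g 𝔚) :
    compatibleToRatFn L 𝔚 hcov h ∈ (D.classPullback g).sections L :=
  isSection_toRatFn 𝔚 hcov h.2

variable (L)

/-- The `L`-linear map from compatible families to `Γ(Z, 𝒪_Z(D_g))`, `h ↦ h_{a₀} e_{a₀}⁻¹`.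
[folklore] -/
def compatibleToSections : compatible L g 𝔚 →ₗ[L] (D.classPullback g).sections L :=
  LinearMap.codRestrict ((D.classPullback g).sections L) (compatibleToRatFn L 𝔚 hcov)
    (compatibleToRatFn_mem 𝔚 hcov)

variable {L}

/-- `compatibleToSections` on elements. [folklore] -/
theorem val_compatibleToSections (h : compatible L g 𝔚) :
    (compatibleToSections L 𝔚 hcov h).1 = toRatFn L 𝔚 hcov h.1 :=
  rfl

/-- **Injectivity**: if `h_{a₀} e_{a₀}⁻¹ = h'_{a₀} e_{a₀}⁻¹` for compatible families `h, h'` then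
`h = h'` (`Γ(W, 𝒪_Z) → L(Z)` is injective for `W ∋ η_Z`, and `Γ(∅, 𝒪_Z) = 0`). [folklore] -/
theorem compatibleToSections_injective : Function.Injective (compatibleToSections L 𝔚 hcov) := by
  intro h h' e
  have e' : toRatFn L 𝔚 hcov h.1 = toRatFn L 𝔚 hcov h'.1 := congr_arg Subtype.val e
  apply Subtype.ext
  funext σ
  obtain ⟨a, rfl⟩ := OrderedCech.exists_eq_vertex σ
  by_cases ha : genericPoint Z ∈ g ⁻¹ᵁ 𝔚.opens (OrderedCech.vertex a).1
  · rw [toRatFn_eq_ratFn 𝔚 hcov h.2 ha, toRatFn_eq_ratFn 𝔚 hcov h'.2 ha, ratFn, ratFn] at e'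
    have e'' := mul_right_cancel₀ (inv_ne_zero (eqn_ne_zero _ ha)) e'
    exact germ_injective_of_isIntegral Z _ ha e''
  · haveI := subsingleton_sections_of_notMem ha
    exact Subsingleton.elim _ _

/-! ### Surjectivity: the family of a section -/

open scoped Classical in
/-- **The family of a global section** `s` of `𝒪_Z(D_g)`: `h_σ =` the section of `𝒪_Z` over
`g⁻¹W_σ` with rational function `e_σ · s` (regular there, `e_σ` being the equation of `D_g` on
`g⁻¹U_{c(σ)} ⊇ g⁻¹W_σ`; `0` if `g⁻¹W_σ = ∅`). [folklore] -/
def familyOf (s : (D.classPullback g).sections L) (σ : OrderedCech.Simplex (Fin (𝔚.r + 1)) 0) :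
    Γ(Z, g ⁻¹ᵁ 𝔚.opens σ.1) :=
  if hξ : genericPoint Z ∈ g ⁻¹ᵁ 𝔚.opens σ.1 then
    sectionOf hξ (eqn g 𝔚 σ.1 σ.2.1 * (s : Z.functionField)) fun z hz => by
      rw [← classPullback_f_chart σ.2.1 hξ]
      exact s.2 _ z ⟨𝔚.opens_le_U_chartOf _ _ hz, trivial⟩
  else 0

/-- The rational function of `familyOf s σ` is `e_σ · s` (when `g⁻¹W_σ ∋ η_Z`). [folklore] -/
theorem ofSection_familyOf (s : (D.classPullback g).sections L)
    (σ : OrderedCech.Simplex (Fin (𝔚.r + 1)) 0) (hξ : genericPoint Z ∈ g ⁻¹ᵁ 𝔚.opens σ.1) :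
    ofSection hξ (familyOf 𝔚 s σ) = eqn g 𝔚 σ.1 σ.2.1 * (s : Z.functionField) := by
  classical
  unfold familyOf
  rw [dif_pos hξ, ofSection_sectionOf]

/-- **The family of a section is compatible**: on `g⁻¹W_{ab} ∋ η_Z` both `h_a` and
`h_b g^♯(u_{ab})` have rational function `e_a s` (`e_b g^♯(u_{ab}) = e_a`); over `∅` there is
nothing to check. [folklore] -/
theorem familyOf_mem (s : (D.classPullback g).sections L) : familyOf 𝔚 s ∈ compatible L g 𝔚 := by
  refine mem_compatible_iff.2 fun τ => section_ext fun hξ => ?_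
  have hsrc : genericPoint Z ∈ g ⁻¹ᵁ 𝔚.opens (OrderedCech.src τ).1 :=
    g.preimage_mono (𝔚.opens_le_opens_src τ) hξ
  have htgt : genericPoint Z ∈ g ⁻¹ᵁ 𝔚.opens (OrderedCech.tgt τ).1 :=
    g.preimage_mono (𝔚.opens_le_opens_tgt τ) hξ
  simp only [map_mul, ofSection_map]
  rw [ofSection_familyOf 𝔚 _ _ hsrc, ofSection_familyOf 𝔚 _ _ htgt, mul_right_comm,
    eqn_tgt_mul_ofSection_unitSection τ hξ]

/-- **Surjectivity**: `toRatFn (familyOf s) = s`. [folklore] -/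
theorem toRatFn_familyOf (s : (D.classPullback g).sections L) :
    toRatFn L 𝔚 hcov (familyOf 𝔚 s) = (s : Z.functionField) := by
  rw [toRatFn_apply, ratFn, ofSection_familyOf, mul_comm,
    inv_mul_cancel_left₀ (eqn_ne_zero _ (genericPoint_mem_vertex₀ 𝔚 hcov))]

/-- `compatibleToSections` is surjective. [folklore] -/
theorem compatibleToSections_surjective :
    Function.Surjective (compatibleToSections L 𝔚 hcov) := fun s =>
  ⟨⟨familyOf 𝔚 s, familyOf_mem 𝔚 s⟩, Subtype.ext (toRatFn_familyOf 𝔚 hcov s)⟩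

variable (L)

/-- **Compatible families `≅ Γ(Z, 𝒪_Z(D_g))`** as `L`-vector spaces: the sheaf axiom
`Ȟ⁰((g⁻¹W_a)_a, 𝒪_Z(D_g)) = Γ(Z, 𝒪_Z(D_g))` (Görtz–Wedhorn II, Lemma 21.65) for the line bundle
`𝒪_Z(D_g) ≅ g^*𝒪_Y(D)` trivialised by `g^*(f_{c(a)}⁻¹)` on `g⁻¹W_a` (Görtz–Wedhorn I, (11.16)), in
the function-field model. [cite: GortzWedhorn2023, Lemma 21.65 (p. 259)] -/
def compatibleEquivSections : compatible L g 𝔚 ≃ₗ[L] (D.classPullback g).sections L :=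
  LinearEquiv.ofBijective (compatibleToSections L 𝔚 hcov)
    ⟨compatibleToSections_injective 𝔚 hcov, compatibleToSections_surjective 𝔚 hcov⟩

variable {L}

/-- `compatibleEquivSections` on elements: the rational function `h_{a₀} e_{a₀}⁻¹`. [folklore] -/
theorem val_compatibleEquivSections (h : compatible L g 𝔚) :
    (compatibleEquivSections L 𝔚 hcov h).1 = toRatFn L 𝔚 hcov h.1 :=
  rfl

end OverField

end FieldPointBaseChange

end Literature.AlgebraicGeometry.Motives

end
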